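import Summits.ResolutionOfSingularities.ResolutionOfSingularities.Theorems.FrobeniusLadderFInjectiveMacaulayficationGradedChartDescent
import Summits.ResolutionOfSingularities.ResolutionOfSingularities.Theorems.FrobeniusLadderFInjectiveMacaulayficationLaurentDescent
import HarnessLib

/-!
# The Laurent step of the graded engine, generic form (crux `FInjectiveMacaulayfication`, §16 G4)

Support file for crux stmt-ResolutionOfSingularities-15315 (`FrobeniusLadder.FInjectiveMacaulayfication`), §16 THE
GRADED ENGINE (CRUX-PLAN w45a v3, line `graded-engine`, registered stub G4 `stub_gradedChartClause`; lead seat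
res-L1-w45a-lead-1; design memo GRADED-ENGINE.md v2, steps (v)–(vi)). [OURS · L1 W4.5a]

Generic glue combining `GradedChartDescent.clause_of_isLocalization_away` (p485629) with the Laurent descent
`LaurentDescent.laurentDescent` (p470480): if `S = A[Y]_Y` along `e : A[Y] → S` satisfies the clause at its maximal
ideals containing `b'`, and `b' = a · e(C t)` for some `t` in a maximal ideal `Q` of `A`, then — granted the dimension
count `dim A[Y]_𝔑 = dim A_Q + 1` at maximal `𝔑` — the local ring `A_Q` satisfies the clause. Stated for arbitrary
commutative rings so that the assembly of G4 only instantiates (`A` = the weighted blow-up chart, `S` = the Veronese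
subalgebra, `b' = s^N`, `t = u`). No definitions, no named facts. [folklore]
-/

set_option linter.dupNamespace false

noncomputable section

open Polynomial

namespace Summit.ResolutionOfSingularities.ResolutionOfSingularities.Theorems.FInjectiveMacaulayfication.GradedChartLaurentStep

open Summit.ResolutionOfSingularities.ResolutionOfSingularities.Theorems.FInjectiveMacaulayfication

/-- **Laurent step.** `e : A[Y] → S` a localisation at `Y`; the clause for `S` at its maximal ideals containing `b'`;
`Q ⊆ A` maximal, `t ∈ Q` with `b' = a · e(C t)`; `dim A[Y]_𝔑 = dim A_Q + 1` for maximal `𝔑`. Then `A_Q` satisfies the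
clause: with `𝔑 = Q A[Y] + (Y - 1)` (maximal, `Y ∉ 𝔑`, `b' ∈ 𝔑 S`), `A[Y]_𝔑` satisfies the clause by
`clause_of_isLocalization_away`, and `LaurentDescent.laurentDescent` descends it to `A_Q`. [folklore] -/
theorem clause_of_isLocalization_away_descent (p : ℕ) [Fact p.Prime] {A S : Type} [CommRing A] [CommRing S]
    (e : Polynomial A →+* S) (hloc : @IsLocalization.Away (Polynomial A) _ Polynomial.X S _ e.toAlgebra) (b' : S)
    (hcl : ∀ (𝔫' : Ideal S) [𝔫'.IsMaximal], b' ∈ 𝔫' →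
      ∀ d : ℕ, ringKrullDim (Localization.AtPrime 𝔫') = d → ∀ s : Fin d → Localization.AtPrime 𝔫',
        (Ideal.span (Set.range s)).radical.IsMaximal →
          RingTheory.Sequence.IsWeaklyRegular (Localization.AtPrime 𝔫') (List.ofFn s) ∧
          ∀ y : Localization.AtPrime 𝔫', (∃ e : ℕ, y ^ p ^ e ∈ Ideal.span
            ((fun z : Localization.AtPrime 𝔫' => z ^ p ^ e) ''
              (Ideal.span (Set.range s) : Set (Localization.AtPrime 𝔫')))) → y ∈ Ideal.span (Set.range s))
    (Q : Ideal A) [Q.IsMaximal] (t : A) (htQ : t ∈ Q) (a : S) (hb' : b' = a * e (Polynomial.C t))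
    (hdim : ∀ (𝔑 : Ideal (Polynomial A)) [𝔑.IsMaximal], ∀ d : ℕ, ringKrullDim (Localization.AtPrime Q) = d →
      ringKrullDim (Localization.AtPrime 𝔑) = ((d + 1 : ℕ) : WithBot ℕ∞)) :
    ∀ d : ℕ, ringKrullDim (Localization.AtPrime Q) = d → ∀ s : Fin d → Localization.AtPrime Q,
      (Ideal.span (Set.range s)).radical.IsMaximal →
        RingTheory.Sequence.IsWeaklyRegular (Localization.AtPrime Q) (List.ofFn s) ∧
        ∀ y : Localization.AtPrime Q, (∃ e : ℕ, y ^ p ^ e ∈ Ideal.span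
          ((fun z : Localization.AtPrime Q => z ^ p ^ e) ''
            (Ideal.span (Set.range s) : Set (Localization.AtPrime Q)))) → y ∈ Ideal.span (Set.range s) := by
  -- the ideal `𝔑 = Q A[Y] + (Y - 1)`
  obtain ⟨𝔑, h𝔑⟩ : ∃ 𝔑 : Ideal (Polynomial A), 𝔑 = Q.map (Polynomial.C : A →+* A[X]) ⊔ Ideal.span {(X - 1 : A[X])} :=
    ⟨_, rfl⟩
  haveI h𝔑max : 𝔑.IsMaximal := by
    rw [h𝔑, ← LaurentDescent.comap_evalRingHom_one]
    exact Ideal.comap_isMaximal_of_surjective _ fun a => ⟨Polynomial.C a, by simp⟩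
  have hX𝔑 : (Polynomial.X : Polynomial A) ∉ 𝔑 := fun hX => by
    have h1 : (X : A[X]) - (X - 1) ∈ 𝔑 := 𝔑.sub_mem hX (h𝔑 ▸ Ideal.mem_sup_right (Ideal.subset_span rfl))
    rw [sub_sub_cancel] at h1
    exact h𝔑max.ne_top ((Ideal.eq_top_iff_one _).mpr h1)
  have hb'' : ∃ y ∈ 𝔑, ∃ a : S, b' = a * e y :=
    ⟨Polynomial.C t, h𝔑 ▸ Ideal.mem_sup_left (Ideal.mem_map_of_mem _ htQ), a, hb'⟩
  exact LaurentDescent.laurentDescent p A Q 𝔑 h𝔑 (hdim 𝔑)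
    (GradedChartDescent.clause_of_isLocalization_away p e hloc b' hcl 𝔑 hX𝔑 hb'')

end Summit.ResolutionOfSingularities.ResolutionOfSingularities.Theorems.FInjectiveMacaulayfication.GradedChartLaurentStep

end
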